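import Literature.Analysis.FluidPDE.NSEssEndpointOfHigherRegularity
import Literature.Analysis.FluidPDE.NSBoundedHigherRegularityQuantProofs
import HarnessLib

/-!
# `ess_endpoint_holds`: the Escauriaza–Seregin–Šverák endpoint criterion `L^∞_t L³_x` (ESS 2003, Thms. 1.3–1.4)

Analysis/FluidPDE proof file (theorems only: no definition, no named fact, no `sorry`).  It composes
reductions that are already in the tree with the discharge of the quantitative higher-regularity
theorem for bounded distributional Navier–Stokes solutions, `NSBoundedHigherRegularityBounds_holds`
(`NSBoundedHigherRegularityQuantProofs.lean`; Seregin–Šverák 2009, §2 p. 8 = Serrin's interior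
regularity with constants, proved by the Serrin bootstrap `NSBootstrap*.lean`), which was the last
open hypothesis of each reduction used below.  No statement is changed; each `theorem X_holds : X`
turns the named fact `X` from literature debt into a theorem.
-/

namespace Literature.Analysis.FluidPDE

/-- **ESS 2003, Thm. 1.3 (1.14) (the `L₅` integrability), proved**: `ess_L5_integrability` holds — `ess_L5_integrability_of_higherRegularityBounds` (NSEssEndpointOfHigherRegularity.lean) fed with `NSBoundedHigherRegularityBounds_holds`.
[cite: EscauriazaSereginSverak2003, Thm. 1.3 (1.14)] -/
theorem ess_L5_integrability_holds : ess_L5_integrability :=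
  ess_L5_integrability_of_higherRegularityBounds NSBoundedHigherRegularityBounds_holds

/-- **ESS 2003, Thms. 1.3–1.4 (endpoint regularity `L^∞_t L³_x`; ns.S08), proved**: `ess_endpoint` holds — `ess_endpoint_of_higherRegularityBounds` (NSEssEndpointOfHigherRegularity.lean) fed with `NSBoundedHigherRegularityBounds_holds`.
[cite: EscauriazaSereginSverak2003, Thms. 1.3–1.4] [cite: RobinsonRodrigoSadowski2016, Thm. 16.4] -/
theorem ess_endpoint_holds : ess_endpoint :=
  ess_endpoint_of_higherRegularityBounds NSBoundedHigherRegularityBounds_holds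

end Literature.Analysis.FluidPDE
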